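import Summits.QuantumFields.QCD.Theses.PauliWegnerSea

/-!
# Crux `TiltedFlatness` (K3 of `PauliWegnerSea`), negative side — the constants of `FibreSmallBalls` depend on `n`

Support file of the standing disprover (gen 2) of item stmt-QuantumFields-14070 (line `circle-transport`,
skeleton r2b, stub `stub_haarSmallBalls`: `∀ D n, ∃ C c > 0, …` for continuous `F ≥ 0` on `E → SU(3)`
depending on `≤ n` listed coordinates with `F²` band-limited of degree `≤ D` along the two-sided circles
`A·T(t)·B`, `Haar^{⊗E}{F ≤ ε F(W₀)} ≤ C ε^c`).

**Theorem `not_fibreSmallBalls_uniform_in_n`.**  With `Fintype.card ι ≤ n` dropped (constants depending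
on `D` only) the statement is FALSE: `F(W) = Π_{e<N} √((1 + Re W(e)₀₀)/2)` has `F²` of degree `1` along
every two-sided circle (`entry00_twoSided`: `(A·T(t)·B)₀₀ = A₀₀B₀₀e^{it} + A₀₁B₁₀e^{−it} + A₀₂B₂₀`),
`F(1) = 1`, and `Haar^N{F ≤ ε} ≥ 1 − (1 − Haar{φ < ε})^N → 1` (`N → ∞`) for every fixed `ε > 0`.
Abstract twin of `not_tiltedFlatness_uniform_in_Nf` (`NfDependence.lean`); for the crux `n ≤ 16`, so this
only says that the constants of `stub_haarSmallBalls` must degrade with `n`.  Standard material. [folklore]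
-/

open MeasureTheory Set Filter
open Literature.MathematicalPhysics.QuantumFieldTheory Literature.MathematicalPhysics.QuantumLattice
  Literature.Probability.LatticeModels

namespace Summit.QuantumFields.QCD.Theorems.TiltedFlatnessNegative

/-- Entries of a special unitary matrix have norm `≤ 1` (private copy). [folklore] -/
private theorem entry_norm_le_one (g : (Matrix.specialUnitaryGroup (Fin 3) ℂ)) (i j : Fin 3) : ‖(g : Matrix (Fin 3) (Fin 3) ℂ) i j‖ ≤ 1 := by
  have := g.2
  rw [Matrix.mem_specialUnitaryGroup_iff] at this
  exact entry_norm_bound_of_unitary this.1 i j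

/-- `-1 ≤ Re g₀₀ ≤ 1` for `g ∈ SU(3)`. [folklore] -/
theorem re00_bounds (g : (Matrix.specialUnitaryGroup (Fin 3) ℂ)) :
    -1 ≤ ((g : Matrix (Fin 3) (Fin 3) ℂ) 0 0).re ∧ ((g : Matrix (Fin 3) (Fin 3) ℂ) 0 0).re ≤ 1 := by
  have h1 := entry_norm_le_one g 0 0
  have h2 := Complex.abs_re_le_norm ((g : Matrix (Fin 3) (Fin 3) ℂ) 0 0)
  constructor
  · linarith [neg_abs_le ((g : Matrix (Fin 3) (Fin 3) ℂ) 0 0).re]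
  · linarith [le_abs_self ((g : Matrix (Fin 3) (Fin 3) ℂ) 0 0).re]

/-- The `(0,0)` entry along a two-sided diagonal circle `A · diag(e^{it}, e^{-it}, 1) · B` is the degree-1
trigonometric polynomial `A₀₀B₀₀ e^{it} + A₀₁B₁₀ e^{-it} + A₀₂B₂₀`. [folklore] -/
theorem entry00_twoSided (T : ℝ → (Matrix.specialUnitaryGroup (Fin 3) ℂ))
    (hT : ∀ θ : ℝ, ((T θ : (Matrix.specialUnitaryGroup (Fin 3) ℂ)) : Matrix (Fin 3) (Fin 3) ℂ) =
      Matrix.diagonal ![Complex.exp (θ * Complex.I), Complex.exp (-(θ * Complex.I)), 1])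
    (A B : (Matrix.specialUnitaryGroup (Fin 3) ℂ)) (t : ℝ) :
    ((A * T t * B : (Matrix.specialUnitaryGroup (Fin 3) ℂ)) : Matrix (Fin 3) (Fin 3) ℂ) 0 0 =
      (A : Matrix (Fin 3) (Fin 3) ℂ) 0 0 * (B : Matrix (Fin 3) (Fin 3) ℂ) 0 0 * Complex.exp (t * Complex.I) +
      (A : Matrix (Fin 3) (Fin 3) ℂ) 0 1 * (B : Matrix (Fin 3) (Fin 3) ℂ) 1 0 * Complex.exp (-(t * Complex.I)) +
      (A : Matrix (Fin 3) (Fin 3) ℂ) 0 2 * (B : Matrix (Fin 3) (Fin 3) ℂ) 2 0 := by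
  have hmul : ((A * T t * B : (Matrix.specialUnitaryGroup (Fin 3) ℂ)) : Matrix (Fin 3) (Fin 3) ℂ) =
      (A : Matrix (Fin 3) (Fin 3) ℂ) * (T t : (Matrix.specialUnitaryGroup (Fin 3) ℂ)) * (B : Matrix (Fin 3) (Fin 3) ℂ) := rfl
  rw [hmul, hT t, Matrix.mul_apply, Fin.sum_univ_three, Matrix.mul_apply, Matrix.mul_apply, Matrix.mul_apply,
    Fin.sum_univ_three, Fin.sum_univ_three, Fin.sum_univ_three]
  simp [Matrix.diagonal]
  ring

/-- The diagonal matrix `diag(-1,-1,1)` is special unitary. [folklore] -/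
theorem negneg_mem_specialUnitaryGroup :
    Matrix.diagonal ![(-1 : ℂ), -1, 1] ∈ Matrix.specialUnitaryGroup (Fin 3) ℂ := by
  rw [Matrix.mem_specialUnitaryGroup_iff, Matrix.mem_unitaryGroup_iff]
  constructor
  · rw [Matrix.star_eq_conjTranspose, Matrix.diagonal_conjTranspose, Matrix.diagonal_mul_diagonal,
      ← Matrix.diagonal_one]
    congr 1
    funext i
    fin_cases i <;> simp
  · rw [Matrix.det_diagonal, Fin.prod_univ_three]
    simp

/-- **The constants of `FibreSmallBalls` must depend on the number `n` of listed coordinates.**  With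
`Fintype.card ι ≤ n` dropped (constants depending on the degree only) the abstract Haar small-ball
statement is FALSE: `F(W) = Π_e φ(W e)`, `φ(g) = √((1 + Re g₀₀)/2)` has `F²` of degree `1` along every
two-sided circle, `F(1) = 1`, and `Haar^N{F ≤ ε} ≥ 1 − (1 − Haar{φ < ε})^N → 1` (`N → ∞`) for every
fixed `ε > 0`.  (Abstract twin of `not_tiltedFlatness_uniform_in_Nf`; irrelevant to the crux, where
`n ≤ 16`, but any proof of `stub_haarSmallBalls` must let `C, c` degrade with `n`.) [folklore] -/
theorem not_fibreSmallBalls_uniform_in_n (T : ℝ → (Matrix.specialUnitaryGroup (Fin 3) ℂ))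
    (hT : ∀ θ : ℝ, ((T θ : (Matrix.specialUnitaryGroup (Fin 3) ℂ)) : Matrix (Fin 3) (Fin 3) ℂ) =
      Matrix.diagonal ![Complex.exp (θ * Complex.I), Complex.exp (-(θ * Complex.I)), 1]) :
    ¬ (∀ D : ℕ, ∃ C c : ℝ, 0 < C ∧ 0 < c ∧
      ∀ (E : Type) [Fintype E] [DecidableEq E] (ι : Type) [Fintype ι] (r : ι → E),
      ∀ F : (E → (Matrix.specialUnitaryGroup (Fin 3) ℂ)) → ℝ, Continuous F → (∀ W, 0 ≤ F W) →
        (∀ W W' : E → (Matrix.specialUnitaryGroup (Fin 3) ℂ), (∀ i, W (r i) = W' (r i)) → F W = F W') →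
        (∀ (W : E → (Matrix.specialUnitaryGroup (Fin 3) ℂ)) (i : ι) (A B : (Matrix.specialUnitaryGroup (Fin 3) ℂ)), ∃ a : ℤ → ℂ, ∀ t : ℝ,
          ((F (Function.update W (r i) (A * T t * B)) ^ 2 : ℝ) : ℂ) =
            ∑ k ∈ Finset.Icc (-(D : ℤ)) D, a k * Complex.exp ((k : ℂ) * (t : ℂ) * Complex.I)) →
        ∀ W₀ : E → (Matrix.specialUnitaryGroup (Fin 3) ℂ), 0 < F W₀ → ∀ ε : ℝ, 0 < ε →
          ((Measure.pi fun _ : E => haarProbability (Matrix.specialUnitaryGroup (Fin 3) ℂ)) {W | F W ≤ ε * F W₀}).toReal ≤ C * ε ^ c) := by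
  intro H
  obtain ⟨C, c, hC, hc, H⟩ := H 1
  -- the one-link amplitude
  let ψ : (Matrix.specialUnitaryGroup (Fin 3) ℂ) → ℝ := fun g => (1 + ((g : Matrix (Fin 3) (Fin 3) ℂ) 0 0).re) / 2
  let φ : (Matrix.specialUnitaryGroup (Fin 3) ℂ) → ℝ := fun g => Real.sqrt (ψ g)
  have hψ_nn : ∀ g, 0 ≤ ψ g := fun g => by
    have := (re00_bounds g).1; show 0 ≤ (1 + _) / 2; linarith
  have hψ_le : ∀ g, ψ g ≤ 1 := fun g => by
    have := (re00_bounds g).2; show (1 + _) / 2 ≤ 1; linarith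
  have hφ_nn : ∀ g, 0 ≤ φ g := fun g => Real.sqrt_nonneg _
  have hφ_le : ∀ g, φ g ≤ 1 := fun g => Real.sqrt_le_one.mpr (hψ_le g) |>.trans_eq rfl
  have hφ_sq : ∀ g, φ g ^ 2 = ψ g := fun g => Real.sq_sqrt (hψ_nn g)
  have hψ_cont : Continuous ψ :=
    (continuous_const.add (Complex.continuous_re.comp
      ((continuous_apply_apply 0 0).comp continuous_subtype_val))).div_const _
  have hφ_cont : Continuous φ := Real.continuous_sqrt.comp hψ_cont
  -- fix `ε` with `C ε^c = 1/2`
  set q : ℝ := 1 / (2 * C) with hq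
  have hq0 : 0 < q := by positivity
  set ε : ℝ := q ^ (1 / c) with hε
  have hε0 : 0 < ε := Real.rpow_pos_of_pos hq0 _
  have hεc : C * ε ^ c = 1 / 2 := by
    rw [hε, ← Real.rpow_mul hq0.le, one_div, inv_mul_cancel₀ hc.ne', Real.rpow_one, hq]
    field_simp
  -- the open set where `φ < ε`, of positive Haar mass `h`
  let V : Set (Matrix.specialUnitaryGroup (Fin 3) ℂ) := {g | ψ g < ε ^ 2}
  have hV_open : IsOpen V := isOpen_lt hψ_cont continuous_const
  have hV_meas : MeasurableSet V := hV_open.measurableSet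
  let g₀ : (Matrix.specialUnitaryGroup (Fin 3) ℂ) := ⟨Matrix.diagonal ![(-1 : ℂ), -1, 1], negneg_mem_specialUnitaryGroup⟩
  have hg₀V : g₀ ∈ V := by
    show (1 + ((Matrix.diagonal ![(-1 : ℂ), -1, 1] : Matrix (Fin 3) (Fin 3) ℂ) 0 0).re) / 2 < ε ^ 2
    simp only [Matrix.diagonal_apply_eq, Matrix.cons_val_zero]
    norm_num
    positivity
  haveI : (haarProbability (Matrix.specialUnitaryGroup (Fin 3) ℂ)).IsOpenPosMeasure := by unfold haarProbability; infer_instance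
  haveI hprob : IsProbabilityMeasure (haarProbability (Matrix.specialUnitaryGroup (Fin 3) ℂ)) := by infer_instance
  have hVpos : 0 < haarProbability (Matrix.specialUnitaryGroup (Fin 3) ℂ) V := hV_open.measure_pos _ ⟨g₀, hg₀V⟩
  have hVle : haarProbability (Matrix.specialUnitaryGroup (Fin 3) ℂ) V ≤ 1 := prob_le_one
  set h : ℝ := (haarProbability (Matrix.specialUnitaryGroup (Fin 3) ℂ) V).toReal with hh
  have hh0 : 0 < h := ENNReal.toReal_pos hVpos.ne' (measure_ne_top _ _)
  have hh1 : h ≤ 1 := by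
    rw [hh, ← ENNReal.toReal_one]; exact ENNReal.toReal_mono ENNReal.one_ne_top hVle
  -- choose `N` with `(1 - h)^N < 1/2`
  obtain ⟨N, hN⟩ : ∃ N : ℕ, (1 - h) ^ N < 1 / 2 :=
    exists_pow_lt_of_lt_one (by norm_num) (by linarith)
  -- the product amplitude on `N` links
  let F : (Fin N → (Matrix.specialUnitaryGroup (Fin 3) ℂ)) → ℝ := fun W => ∏ e, φ (W e)
  have hF_cont : Continuous F := continuous_finsetProd _ fun e _ => hφ_cont.comp (continuous_apply e)
  have hF_nn : ∀ W, 0 ≤ F W := fun W => Finset.prod_nonneg fun e _ => hφ_nn _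
  have hF_dep : ∀ W W' : Fin N → (Matrix.specialUnitaryGroup (Fin 3) ℂ), (∀ i : Fin N, W (id i) = W' (id i)) → F W = F W' := by
    intro W W' hWW'
    have : W = W' := funext fun i => hWW' i
    rw [this]
  have hIcc : Finset.Icc (-((1 : ℕ) : ℤ)) ((1 : ℕ) : ℤ) = {-1, 0, 1} := by decide
  have hF_bl : ∀ (W : Fin N → (Matrix.specialUnitaryGroup (Fin 3) ℂ)) (i : Fin N) (A B : (Matrix.specialUnitaryGroup (Fin 3) ℂ)), ∃ a : ℤ → ℂ, ∀ t : ℝ,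
      ((F (Function.update W (id i) (A * T t * B)) ^ 2 : ℝ) : ℂ) =
        ∑ k ∈ Finset.Icc (-((1 : ℕ) : ℤ)) ((1 : ℕ) : ℤ), a k * Complex.exp ((k : ℂ) * (t : ℂ) * Complex.I) := by
    intro W i A B
    -- the frozen factor
    set P : ℝ := ∏ e ∈ ({i}ᶜ : Finset (Fin N)), ψ (W e) with hP
    set c₁ : ℂ := (A : Matrix (Fin 3) (Fin 3) ℂ) 0 0 * (B : Matrix (Fin 3) (Fin 3) ℂ) 0 0 with hc₁
    set cm : ℂ := (A : Matrix (Fin 3) (Fin 3) ℂ) 0 1 * (B : Matrix (Fin 3) (Fin 3) ℂ) 1 0 with hcm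
    set c₀ : ℂ := (A : Matrix (Fin 3) (Fin 3) ℂ) 0 2 * (B : Matrix (Fin 3) (Fin 3) ℂ) 2 0 with hc₀
    refine ⟨fun k => (P : ℂ) * (if k = 1 then (c₁ + (starRingEnd ℂ) cm) / 4 else
      if k = -1 then (cm + (starRingEnd ℂ) c₁) / 4 else (1 / 2 + (c₀ + (starRingEnd ℂ) c₀) / 4)), fun t => ?_⟩
    -- the square of the product splits off the moving factor
    have hsq : F (Function.update W (id i) (A * T t * B)) ^ 2 = ψ (A * T t * B) * P := by
      show (∏ e, φ (Function.update W i (A * T t * B) e)) ^ 2 = _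
      rw [← Finset.prod_pow, Fintype.prod_eq_mul_prod_compl i]
      congr 1
      · rw [Function.update_self, hφ_sq]
      · refine Finset.prod_congr rfl fun e he => ?_
        rw [Finset.mem_compl, Finset.mem_singleton] at he
        rw [Function.update_of_ne he, hφ_sq]
    rw [hsq, hIcc, Finset.sum_insert (by decide), Finset.sum_insert (by decide), Finset.sum_singleton]
    have hu := entry00_twoSided T hT A B t
    have hψu : ((ψ (A * T t * B) : ℝ) : ℂ) =
        (1 + ((((A * T t * B : (Matrix.specialUnitaryGroup (Fin 3) ℂ)) : Matrix (Fin 3) (Fin 3) ℂ) 0 0) +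
          (starRingEnd ℂ) (((A * T t * B : (Matrix.specialUnitaryGroup (Fin 3) ℂ)) : Matrix (Fin 3) (Fin 3) ℂ) 0 0)) / 2) / 2 := by
      show ((((1 + (((A * T t * B : (Matrix.specialUnitaryGroup (Fin 3) ℂ)) : Matrix (Fin 3) (Fin 3) ℂ) 0 0).re) / 2 : ℝ)) : ℂ) = _
      push_cast
      rw [Complex.re_eq_add_conj]
    have hconj : (starRingEnd ℂ) (((A * T t * B : (Matrix.specialUnitaryGroup (Fin 3) ℂ)) : Matrix (Fin 3) (Fin 3) ℂ) 0 0) =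
        (starRingEnd ℂ) c₁ * Complex.exp (-(t * Complex.I)) +
        (starRingEnd ℂ) cm * Complex.exp (t * Complex.I) + (starRingEnd ℂ) c₀ := by
      rw [hu]
      simp only [hc₁, hcm, hc₀, map_add, map_mul, map_neg, ← Complex.exp_conj, Complex.conj_ofReal,
        Complex.conj_I, mul_neg, neg_neg]
    push_cast
    rw [hψu, hconj, hu]
    simp only [zero_mul, Complex.exp_zero, neg_mul, one_mul]
    ring
  -- the reference point `W₀ ≡ 1`, `F W₀ = 1`
  have hφ1 : φ 1 = 1 := by
    show Real.sqrt ((1 + (((1 : (Matrix.specialUnitaryGroup (Fin 3) ℂ)) : Matrix (Fin 3) (Fin 3) ℂ) 0 0).re) / 2) = 1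
    simp
  let W₀ : Fin N → (Matrix.specialUnitaryGroup (Fin 3) ℂ) := fun _ => 1
  have hFW₀ : F W₀ = 1 := by
    show ∏ e : Fin N, φ ((fun _ => (1 : (Matrix.specialUnitaryGroup (Fin 3) ℂ))) e) = 1
    simp [hφ1]
  -- the sublevel set contains the complement of the box `Π_e Vᶜ`
  let μ : Measure (Fin N → (Matrix.specialUnitaryGroup (Fin 3) ℂ)) := Measure.pi fun _ => haarProbability (Matrix.specialUnitaryGroup (Fin 3) ℂ)
  haveI : IsProbabilityMeasure μ := by
    show IsProbabilityMeasure (Measure.pi fun _ : Fin N => haarProbability (Matrix.specialUnitaryGroup (Fin 3) ℂ)); infer_instance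
  let Bad : Set (Fin N → (Matrix.specialUnitaryGroup (Fin 3) ℂ)) := Set.pi Set.univ fun _ => Vᶜ
  have hBad_meas : MeasurableSet Bad := MeasurableSet.univ_pi fun _ => hV_meas.compl
  have hsub : Badᶜ ⊆ {W | F W ≤ ε * F W₀} := by
    intro W hW
    simp only [Bad, Set.mem_compl_iff, Set.mem_univ_pi, not_forall, not_not] at hW
    obtain ⟨e, he⟩ := hW
    have hφe : φ (W e) ≤ ε := by
      have : ψ (W e) < ε ^ 2 := he
      calc φ (W e) = Real.sqrt (ψ (W e)) := rfl
        _ ≤ Real.sqrt (ε ^ 2) := Real.sqrt_le_sqrt this.le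
        _ = ε := Real.sqrt_sq hε0.le
    show F W ≤ ε * F W₀
    rw [hFW₀, mul_one]
    show ∏ e', φ (W e') ≤ ε
    rw [Fintype.prod_eq_mul_prod_compl e]
    calc φ (W e) * ∏ e' ∈ ({e}ᶜ : Finset (Fin N)), φ (W e') ≤ ε * 1 := by
          apply mul_le_mul hφe (Finset.prod_le_one (fun _ _ => hφ_nn _) fun _ _ => hφ_le _)
            (Finset.prod_nonneg fun _ _ => hφ_nn _) hε0.le
      _ = ε := mul_one ε
  -- the mass of `Bad` is `(1 - h)^N`
  have hBad : μ Bad = (1 - haarProbability (Matrix.specialUnitaryGroup (Fin 3) ℂ) V) ^ N := by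
    show (Measure.pi fun _ : Fin N => haarProbability (Matrix.specialUnitaryGroup (Fin 3) ℂ)) (Set.pi Set.univ fun _ => Vᶜ) = _
    rw [Measure.pi_pi, Finset.prod_const, Finset.card_univ, Fintype.card_fin,
      prob_compl_eq_one_sub hV_meas]
  have hBadc : (μ Badᶜ).toReal = 1 - (1 - h) ^ N := by
    rw [prob_compl_eq_one_sub hBad_meas, hBad,
      ENNReal.toReal_sub_of_le (pow_le_one₀ bot_le tsub_le_self) ENNReal.one_ne_top,
      ENNReal.toReal_one, ENNReal.toReal_pow, ENNReal.toReal_sub_of_le hVle ENNReal.one_ne_top,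
      ENNReal.toReal_one]
  have key := H (Fin N) (Fin N) id F hF_cont hF_nn hF_dep hF_bl W₀ (by rw [hFW₀]; exact one_pos) ε hε0
  have hlow : (μ Badᶜ).toReal ≤ (μ {W | F W ≤ ε * F W₀}).toReal :=
    ENNReal.toReal_mono (measure_ne_top _ _) (measure_mono hsub)
  rw [hBadc] at hlow
  have : 1 - (1 - h) ^ N ≤ C * ε ^ c := hlow.trans key
  rw [hεc] at this
  linarith

end Summit.QuantumFields.QCD.Theorems.TiltedFlatnessNegative
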